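import Summits.ResolutionOfSingularities.ResolutionOfSingularities.Theorems.EquisingularLiftEquisingularLiftNatSpecimenSteinerStrictChart0Packet
import HarnessLib

/-!
# [OURS · L1 W4.5(b) · EL♮(3) · NOSE, N-2 (d) packets 0, 1, 2] STEINER — THE THREE VERTEX-CHART PACKETS OF THE STRICT TRANSFORM, BY THE 𝔖₃-SYMMETRY OF `f`

res-L1-w45b-nose-w2 g2 (WIDTH seat on D-0157 DOOR 1; self-dealt under the desk's N-2 GO, STATUS l.≈83270; nose side not re-dealt in WIDTH TABLE D5). OURS; NOT a
statement of any manuscript ([Hironaka2017] is a candidate under adjudication, nothing of it is asserted); AI-written, weaker than expert review. No `sorry`;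
standard axioms; DEF-FREE (standing `local instance` attribute of the specimen files). `--kind proof --supports stmt-ResolutionOfSingularities-20148 --as helper`;
closes nothing. Resolution of singularities in positive characteristic is NOT proved here or anywhere in this chain (dimension 3 is Cossart–Piltant 2008/2009
in print); EL♮(3) is NOT proved by this file.

WHAT. Packet 0 (✓ `Steiner.packet_chart0`, previous file) read the vertex chart `y₀ ≠ 0` of the blown-up Roman surface through a chart isomorphism
`θ : k[T] ≃ C₀`. The charts `yᵢ ≠ 0` (`i = 1, 2`) are NOT new computations: `f = y₀²y₁² + y₁²y₂² + y₂²y₀² + y₀y₁y₂` is symmetric, so reading `Cᵢ` through the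
TWISTED isomorphism `θ : k[T] ≃ Cᵢ` with `θ T₀ = yᵢ`, `θ T_{σ j} = y_j/yᵢ` (`σ = (0 i)`, `j ≠ i`) gives LITERALLY the packet-0 data: §0 `σ ∘ Subst_i = Subst_{σ i} ∘ σ`
(conjugation of Hu's substitution by a permutation of the variables), `σ f = f`, hence `algebraMap f = yᵢ³ · θ f₁` in `Cᵢ` with the SAME `f₁`; §1 the strict
transform on `Spec Cᵢ` is `V(θ f₁)`, `𝓘⟨St⟩·𝒪 = (θ f₁)~`; §2 the nose set on `Spec Cᵢ` is `V(y_j/yᵢ : j ≠ i)`, carried by `θ⁻¹` to `(T₁, T₂) = (X_j : j ∈ cenVars)`;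
§3 ★ `packet_chart i` — for EVERY `i : Fin 3`: an open immersion `Spec (k[T]/(f₁)) ⟶ St~` over the polynomial chart `Spec(θ⁻¹) ≫ vertexChart υ i`, covering `St~`
over the range of `vertexChart υ i`, on which `𝓘⟨Z′⟩·𝒪_{St~} = ((T̄₁, T̄₂))~` with blow-up algebras REGULAR (✓ `Steiner.isRegularRing_chart₁/₂` verbatim, all three
times). The twisted `θ` exists (`Cone.exists_algEquiv_pointChart k i` composed with `renameEquiv k σ`; §3 `exists_twisted_algEquiv`).
Remaining for (d): the three far packets (υ an iso off `P`; `k[T]/(g)`, ✓ `isRegularRing_chartFar₁/₂`), `hcov`, then ✓ `isRegular_of_isBlowup_of_chartAtlas` +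
`LinearCentre.isRegular_reducedStrictTransform_of_blowupModel`.
-/

set_option linter.dupNamespace false -- mandated namespace `Summit.<Summit>.<Problem>` of this single-conjunct summit

noncomputable section

open CategoryTheory CategoryTheory.Limits AlgebraicGeometry TopologicalSpace HomogeneousLocalization
open MvPolynomial
open Literature.AlgebraicGeometry.Resolution Literature.AlgebraicGeometry.Resolution.DeJong1996
open Literature.AlgebraicGeometry.Motives Literature.AlgebraicGeometry.Motives.SmoothHypersurface
open Literature.AlgebraicGeometry.Motives.ProjectiveSpace
open AlgebraicGeometry.Scheme.IdealSheafData
open Summit.ResolutionOfSingularities.ResolutionOfSingularities.Theorems.EquisingularLift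

attribute [local instance] MvPolynomial.gradedAlgebra ProjBaseChange.algebraBase

namespace Summit.ResolutionOfSingularities.ResolutionOfSingularities.Cruxes.EquisingularLiftNat.Sections

namespace Steiner

variable (k : Type) [Field k]

/-! ## §0 The 𝔖₃-symmetry: conjugating Hu's substitution, `σ f = f`, and `f = yᵢ³ · θ f₁` in every vertex chart -/

/-- **Conjugation of Hu's substitution by a permutation of the variables**: `σ (Substᵢ G) = Subst_{σ i} (σ G)` (both sides are `k`-algebra maps agreeing on
the variables). [cite: Hu2025, §5 Prop. 5.3] (folklore) -/
theorem rename_coordBlowupSubst (σ : Equiv.Perm (Fin 3)) (i : Fin 3) (G : MvPolynomial (Fin 3) k) :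
    rename σ (coordBlowupSubst k (Set.univ : Set (Fin 3)) i G) = coordBlowupSubst k (Set.univ : Set (Fin 3)) (σ i) (rename σ G) := by
  have h := MvPolynomial.algHom_ext (A := MvPolynomial (Fin 3) k)
    (f := (rename σ).comp (coordBlowupSubst k (Set.univ : Set (Fin 3)) i))
    (g := (coordBlowupSubst k (Set.univ : Set (Fin 3)) (σ i)).comp (rename σ)) fun j => by
      rw [AlgHom.comp_apply, AlgHom.comp_apply, rename_X]
      by_cases hj : j = i
      · subst hj
        rw [coordBlowupSubst_X_self, rename_X, coordBlowupSubst_X_self]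
      · rw [coordBlowupSubst_X_of_mem_of_ne k _ _ (Set.mem_univ j) hj, map_mul, rename_X, rename_X,
          coordBlowupSubst_X_of_mem_of_ne k _ _ (Set.mem_univ _) (σ.injective.ne hj)]
  exact congrArg (fun φ : MvPolynomial (Fin 3) k →ₐ[k] MvPolynomial (Fin 3) k => φ G) h

/-- **`f` is symmetric** under the transposition `(0 i)`. [folklore] -/
theorem rename_swap_f (i : Fin 3) : rename (Equiv.swap 0 i) (f k) = f k := by
  fin_cases i
  · simp [Equiv.swap_self]
  · simp only [f, map_add, map_mul, map_pow, rename_X, Equiv.swap_apply_def]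
    simp; ring
  · simp only [f, map_add, map_mul, map_pow, rename_X, Equiv.swap_apply_def]
    simp; ring

/-- **In every vertex chart `f = yᵢ³ · θ f₁`** for the twisted chart isomorphism `θ T₀ = yᵢ`, `θ T_{σ j} = y_j/yᵢ` (`σ = (0 i)`): the structure map is
`θ ∘ σ ∘ Substᵢ = θ ∘ Subst₀ ∘ σ` (✓ `algebraMap_eq_algEquiv_coordBlowupSubst`, §0), `σ f = f`, and ✓ `Steiner.subst_point_f`. [folklore] -/
theorem algebraMap_f_eq_exc_pow_mul_swap (i : Fin 3) (θ : MvPolynomial (Fin 3) k ≃ₐ[k] PointBlowup.Chart 2 k i)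
    (hθi : θ (X 0) = PointBlowup.exc 2 k i) (hθj : ∀ j : Fin 3, j ≠ i → θ (X (Equiv.swap 0 i j)) = PointBlowup.frac 2 k i j) :
    algebraMap (MvPolynomial (Fin 3) k) (PointBlowup.Chart 2 k i) (f k) = PointBlowup.exc 2 k i ^ 3 * θ (f₁ k) := by
  have hσi : Equiv.swap (0 : Fin 3) i i = 0 := Equiv.swap_apply_right 0 i
  have h := algebraMap_eq_algEquiv_coordBlowupSubst k i ((renameEquiv k (Equiv.swap (0 : Fin 3) i)).trans θ) ?_ ?_ (f k)
  · rw [h, AlgEquiv.trans_apply, renameEquiv_apply, rename_coordBlowupSubst, hσi, rename_swap_f, subst_point_f, map_mul, map_pow, hθi]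
  · rw [AlgEquiv.trans_apply, renameEquiv_apply, rename_X, hσi, hθi]
  · intro j hj
    rw [AlgEquiv.trans_apply, renameEquiv_apply, rename_X]
    exact hθj j hj

/-- `θ f₁` is prime (transport of ✓ `Steiner.prime_f₁`). [folklore] -/
theorem prime_algEquiv_f₁_chart (i : Fin 3) (θ : MvPolynomial (Fin 3) k ≃ₐ[k] PointBlowup.Chart 2 k i) : Prime (θ (f₁ k)) :=
  (MulEquiv.prime_iff θ.toMulEquiv).mpr (prime_f₁ k)

/-- `yᵢ ∉ (θ f₁)` when `θ T₀ = yᵢ` (else `f₁ ∣ T₀`, contradicting `T₀ ∤ f₁`, ✓ `X_zero_not_dvd_f₁`). [folklore] -/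
theorem exc_notMem_span_algEquiv_f₁_chart (i : Fin 3) (θ : MvPolynomial (Fin 3) k ≃ₐ[k] PointBlowup.Chart 2 k i)
    (hθi : θ (X 0) = PointBlowup.exc 2 k i) : PointBlowup.exc 2 k i ∉ Ideal.span {θ (f₁ k)} := by
  intro h
  rw [Ideal.mem_span_singleton, ← hθi] at h
  have hdvd : f₁ k ∣ X 0 := by
    obtain ⟨q, hq⟩ := h
    refine ⟨θ.symm q, θ.injective ?_⟩
    rw [map_mul, AlgEquiv.apply_symm_apply]; exact hq
  have hXp : Prime (X 0 : MvPolynomial (Fin 3) k) := MvPolynomial.X_prime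
  rcases hXp.irreducible.dvd_iff.mp hdvd with hu | hassoc
  · exact (prime_f₁ k).not_unit hu
  · exact X_zero_not_dvd_f₁ k hassoc.dvd

/-! ## §1 The strict transform on the vertex chart `Spec Cᵢ` -/

section Chart

variable {k} {F₂ : Scheme.{0}} {υ : F₂ ⟶ SpecimenQuarticTcDelta.P3 k} (hυ : IsBlowup υ (vertexIdealSheaf 2 k))

include hυ in
/-- **The punctured strict transform on the chart `yᵢ ≠ 0`**: `cᵢ 𝔭 ∈ υ⁻¹(ι(S) ∖ {P}) ↔ θ f₁ ∈ 𝔭 ∧ yᵢ ∉ 𝔭`. [folklore] -/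
theorem vertexChart_apply_mem_strict_iff (i : Fin 3) (θ : MvPolynomial (Fin 3) k ≃ₐ[k] PointBlowup.Chart 2 k i)
    (hθi : θ (X 0) = PointBlowup.exc 2 k i) (hθj : ∀ j : Fin 3, j ≠ i → θ (X (Equiv.swap 0 i j)) = PointBlowup.frac 2 k i j)
    (𝔭 : Spec (.of (PointBlowup.Chart 2 k i))) :
    vertexChart hυ i 𝔭 ∈ υ ⁻¹' (Set.range (hypersurfaceι (form k)).left \ {vertex 2 k}) ↔
      θ (f₁ k) ∈ 𝔭.asIdeal ∧ PointBlowup.exc 2 k i ∉ 𝔭.asIdeal := by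
  have h1 := vertexChart_apply_mem_range_iff hυ i 𝔭
  have h2 := vertexChart_apply_eq_vertex_iff hυ i 𝔭
  rw [algebraMap_f_eq_exc_pow_mul_swap k i θ hθi hθj] at h1
  change (υ (vertexChart hυ i 𝔭) ∈ Set.range (hypersurfaceι (form k)).left ∧ ¬ υ (vertexChart hυ i 𝔭) = vertex 2 k) ↔ _
  refine (h1.and h2.not).trans ?_
  constructor
  · rintro ⟨hmem, hexc⟩
    exact ⟨((𝔭.2.mem_or_mem hmem).resolve_left fun h => hexc (𝔭.2.mem_of_pow_mem 3 h)), hexc⟩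
  · rintro ⟨hmem, hexc⟩
    exact ⟨Ideal.mul_mem_left _ _ hmem, hexc⟩

include hυ in
/-- **`cᵢ⁻¹ St = V(θ f₁)`** (closure of the generic point `(θ f₁)`, which lies off `V(yᵢ)`). [cite: Hartshorne1977, II §7 (strict transform)] (OURS computation) -/
theorem preimage_vertexChart_strict (i : Fin 3) (θ : MvPolynomial (Fin 3) k ≃ₐ[k] PointBlowup.Chart 2 k i)
    (hθi : θ (X 0) = PointBlowup.exc 2 k i) (hθj : ∀ j : Fin 3, j ≠ i → θ (X (Equiv.swap 0 i j)) = PointBlowup.frac 2 k i j) :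
    (vertexChart hυ i) ⁻¹' closure (υ ⁻¹' (Set.range (hypersurfaceι (form k)).left \ {vertex 2 k})) =
      PrimeSpectrum.zeroLocus {θ (f₁ k)} := by
  rw [(vertexChart hυ i).isOpenEmbedding.isOpenMap.preimage_closure_eq_closure_preimage (vertexChart hυ i).continuous]
  have hset : (vertexChart hυ i) ⁻¹' (υ ⁻¹' (Set.range (hypersurfaceι (form k)).left \ {vertex 2 k})) =
      {𝔭 : PrimeSpectrum (PointBlowup.Chart 2 k i) | θ (f₁ k) ∈ 𝔭.asIdeal ∧ PointBlowup.exc 2 k i ∉ 𝔭.asIdeal} := by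
    ext 𝔭; exact vertexChart_apply_mem_strict_iff hυ i θ hθi hθj 𝔭
  rw [hset]
  apply le_antisymm
  · refine closure_minimal (fun 𝔭 h𝔭 => ?_) (PrimeSpectrum.isClosed_zeroLocus _)
    exact (SpecimenQuarticTcDelta.mem_zeroLocus_singleton_iff' 𝔭 _).mpr h𝔭.1
  · let q : PrimeSpectrum (PointBlowup.Chart 2 k i) :=
      ⟨Ideal.span {θ (f₁ k)}, (Ideal.span_singleton_prime (prime_algEquiv_f₁_chart k i θ).ne_zero).mpr (prime_algEquiv_f₁_chart k i θ)⟩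
    have hq : q ∈ {𝔭 : PrimeSpectrum (PointBlowup.Chart 2 k i) | θ (f₁ k) ∈ 𝔭.asIdeal ∧ PointBlowup.exc 2 k i ∉ 𝔭.asIdeal} :=
      ⟨Ideal.subset_span rfl, exc_notMem_span_algEquiv_f₁_chart k i θ hθi⟩
    calc PrimeSpectrum.zeroLocus {θ (f₁ k)}
        = closure {q} := by
          rw [← PrimeSpectrum.zeroLocus_span {θ (f₁ k)}]; exact (PrimeSpectrum.closure_singleton q).symm
      _ ≤ _ := closure_mono (Set.singleton_subset_iff.mpr hq)

include hυ in
/-- ★ **`𝓘⟨St⟩ · 𝒪_{Spec Cᵢ} = (θ f₁)~`** for every vertex chart, read through the twisted `θ`. [OURS · L1 W4.5b · (d) packets 0–2] -/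
theorem comap_vertexChart_vanishingIdeal_strict (i : Fin 3) (θ : MvPolynomial (Fin 3) k ≃ₐ[k] PointBlowup.Chart 2 k i)
    (hθi : θ (X 0) = PointBlowup.exc 2 k i) (hθj : ∀ j : Fin 3, j ≠ i → θ (X (Equiv.swap 0 i j)) = PointBlowup.frac 2 k i j) :
    (vanishingIdeal (⟨closure (υ ⁻¹' (Set.range (hypersurfaceι (form k)).left \ {vertex 2 k})), isClosed_closure⟩ : Closeds F₂)).comap
        (vertexChart hυ i) =
      ofIdealTop ((Ideal.span {θ (f₁ k)}).map (Scheme.ΓSpecIso (CommRingCat.of (PointBlowup.Chart 2 k i))).inv.hom) := by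
  rw [comap_vanishingIdeal_of_isOpenImmersion]
  have h : (Closeds.preimage (⟨closure (υ ⁻¹' (Set.range (hypersurfaceι (form k)).left \ {vertex 2 k})), isClosed_closure⟩ : Closeds F₂)
      (vertexChart hυ i).continuous) = ⟨PrimeSpectrum.zeroLocus {θ (f₁ k)}, PrimeSpectrum.isClosed_zeroLocus _⟩ :=
    Closeds.ext (preimage_vertexChart_strict hυ i θ hθi hθj)
  rw [h, SpecimenQuarticTcDelta.vanishingIdeal_zeroLocus_Spec,
    ((Ideal.span_singleton_prime (prime_algEquiv_f₁_chart k i θ).ne_zero).mpr (prime_algEquiv_f₁_chart k i θ)).radical]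

/-! ## §2 The nose set on `Spec Cᵢ` and its transport to `k[T]` -/

include hυ in
/-- The nose set meets `Spec Cᵢ` in `V(y_j/yᵢ : j ≠ i)` (only the strict transform of the line `i` is visible there). [folklore] -/
theorem preimage_vertexChart_noseSet (i : Fin 3) :
    (vertexChart hυ i) ⁻¹' (⋃ j : Fin 3, vertexLineStrict υ j) =
      PrimeSpectrum.zeroLocus (Ideal.span (PointBlowup.frac 2 k i '' {i}ᶜ) : Set (PointBlowup.Chart 2 k i)) := by
  rw [Set.preimage_iUnion]
  ext 𝔭
  simp only [Set.mem_iUnion]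
  constructor
  · rintro ⟨j, hj⟩
    by_cases h0 : j = i
    · subst h0; rwa [preimage_vertexChart_vertexLineStrict hυ j] at hj
    · rw [preimage_vertexChart_vertexLineStrict_of_ne hυ j (Ne.symm h0)] at hj; exact absurd hj (Set.notMem_empty _)
  · intro h
    exact ⟨i, by rwa [preimage_vertexChart_vertexLineStrict hυ i]⟩

include hυ in
/-- **`𝓘⟨Z′⟩·𝒪_{Spec Cᵢ} = (y_j/yᵢ : j ≠ i)~`** (prime, ✓ `isPrime_span_frac`). [folklore] -/
theorem comap_vertexChart_vanishingIdeal_noseSet (i : Fin 3) :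
    (vanishingIdeal (⟨⋃ j : Fin 3, vertexLineStrict υ j, isClosed_iUnion_vertexLineStrict υ⟩ : Closeds F₂)).comap (vertexChart hυ i) =
      affineBlowup.idealSheaf (Ideal.span (PointBlowup.frac 2 k i '' {i}ᶜ)) := by
  rw [comap_vanishingIdeal_of_isOpenImmersion]
  have h : (Closeds.preimage (⟨⋃ j : Fin 3, vertexLineStrict υ j, isClosed_iUnion_vertexLineStrict υ⟩ : Closeds F₂) (vertexChart hυ i).continuous) =
      ⟨PrimeSpectrum.zeroLocus (Ideal.span (PointBlowup.frac 2 k i '' {i}ᶜ) : Set (PointBlowup.Chart 2 k i)), PrimeSpectrum.isClosed_zeroLocus _⟩ :=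
    Closeds.ext (preimage_vertexChart_noseSet hυ i)
  rw [h]
  refine (SpecimenQuarticTcDelta.vanishingIdeal_zeroLocus_Spec (CommRingCat.of (PointBlowup.Chart 2 k i)) _).trans ?_
  rw [Ideal.span_eq, (isPrime_span_frac i).radical]
  rfl

/-- `θ⁻¹` carries `(θ f₁)` back to `(f₁)`. [folklore] -/
theorem map_symm_span_algEquiv_f₁_chart (i : Fin 3) (θ : MvPolynomial (Fin 3) k ≃ₐ[k] PointBlowup.Chart 2 k i) :
    (Ideal.span {θ (f₁ k)}).map (θ.symm.toRingEquiv : PointBlowup.Chart 2 k i →+* MvPolynomial (Fin 3) k) = Ideal.span {f₁ k} := by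
  rw [Ideal.map_span, Set.image_singleton]
  exact congrArg (fun x => Ideal.span {x}) (θ.symm_apply_apply (f₁ k))

/-- The twisted `θ⁻¹` carries the ratios `{y_j/yᵢ : j ≠ i}` to the centre variables `{T₁, T₂}` of ✓ p649392's chart rings (`σ {i}ᶜ = {0}ᶜ`). [folklore] -/
theorem map_symm_span_frac_swap (i : Fin 3) (θ : MvPolynomial (Fin 3) k ≃ₐ[k] PointBlowup.Chart 2 k i)
    (hθj : ∀ j : Fin 3, j ≠ i → θ (X (Equiv.swap 0 i j)) = PointBlowup.frac 2 k i j) :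
    (Ideal.span (PointBlowup.frac 2 k i '' {i}ᶜ)).map (θ.symm.toRingEquiv : PointBlowup.Chart 2 k i →+* MvPolynomial (Fin 3) k) =
      Ideal.span (X '' CuspCone.cenVars) := by
  have hcen : (CuspCone.cenVars : Set (Fin 3)) = {(0 : Fin 3)}ᶜ := by
    ext j; fin_cases j <;> simp [CuspCone.cenVars]
  have hX : ∀ j : Fin 3, j ≠ i → (θ.symm.toRingEquiv : PointBlowup.Chart 2 k i →+* MvPolynomial (Fin 3) k) (PointBlowup.frac 2 k i j) =
      X (Equiv.swap 0 i j) := fun j hj => by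
    have h := congrArg θ.symm (hθj j hj)
    rw [AlgEquiv.symm_apply_apply] at h
    simpa using h.symm
  rw [Ideal.map_span, Set.image_image, hcen]
  refine congrArg Ideal.span (Set.Subset.antisymm ?_ ?_)
  · rintro x ⟨j, hj, rfl⟩
    refine ⟨Equiv.swap 0 i j, fun h => hj ?_, (hX j hj).symm⟩
    exact (Equiv.swap 0 i).injective (h.trans (Equiv.swap_apply_right 0 i).symm)
  · rintro x ⟨j, hj, rfl⟩
    refine ⟨Equiv.swap 0 i j, fun h => hj ?_, ?_⟩
    · have h' : j = Equiv.swap 0 i i := Equiv.swap_apply_eq_iff.mp h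
      rw [h', Equiv.swap_apply_right]; rfl
    · have hne : Equiv.swap 0 i j ≠ i := fun h => hj (by
        have h' : j = Equiv.swap 0 i i := Equiv.swap_apply_eq_iff.mp h
        rw [h', Equiv.swap_apply_right]; rfl)
      beta_reduce
      rw [hX _ hne, Equiv.swap_apply_self]

include hυ in
/-- **The polynomial vertex chart** `Spec(θ⁻¹) ≫ vertexChart υ i : Spec k[T] ⟶ F₂` pulls `𝓘⟨St⟩` back to `(f₁)~` and `𝓘⟨Z′⟩` to `(T₁, T₂)~`. [folklore] -/
theorem comap_polyChart (i : Fin 3) (θ : MvPolynomial (Fin 3) k ≃ₐ[k] PointBlowup.Chart 2 k i)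
    (hθi : θ (X 0) = PointBlowup.exc 2 k i) (hθj : ∀ j : Fin 3, j ≠ i → θ (X (Equiv.swap 0 i j)) = PointBlowup.frac 2 k i j) :
    (vanishingIdeal (⟨closure (υ ⁻¹' (Set.range (hypersurfaceι (form k)).left \ {vertex 2 k})), isClosed_closure⟩ : Closeds F₂)).comap
        (Spec.map (CommRingCat.ofHom (θ.symm.toRingEquiv : PointBlowup.Chart 2 k i →+* MvPolynomial (Fin 3) k)) ≫ vertexChart hυ i) =
      affineBlowup.idealSheaf (Ideal.span {f₁ k}) ∧
    (vanishingIdeal (⟨⋃ j : Fin 3, vertexLineStrict υ j, isClosed_iUnion_vertexLineStrict υ⟩ : Closeds F₂)).comap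
        (Spec.map (CommRingCat.ofHom (θ.symm.toRingEquiv : PointBlowup.Chart 2 k i →+* MvPolynomial (Fin 3) k)) ≫ vertexChart hυ i) =
      affineBlowup.idealSheaf (Ideal.span (X '' CuspCone.cenVars)) := by
  constructor
  · rw [Scheme.IdealSheafData.comap_comp, comap_vertexChart_vanishingIdeal_strict hυ i θ hθi hθj]
    change (affineBlowup.idealSheaf (Ideal.span {θ (f₁ k)})).comap _ = _
    rw [affineBlowup.comap_idealSheaf_specMap, map_symm_span_algEquiv_f₁_chart]
  · rw [Scheme.IdealSheafData.comap_comp, comap_vertexChart_vanishingIdeal_noseSet hυ i, affineBlowup.comap_idealSheaf_specMap,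
      map_symm_span_frac_swap i θ hθj]

/-! ## §3 The packets -/

/-- **The twisted chart isomorphism exists** for every `i`: `θ := θ₀ ∘ σ` with `θ₀` from ✓ `Cone.exists_algEquiv_pointChart k i`. [folklore] -/
theorem exists_twisted_algEquiv (i : Fin 3) :
    ∃ θ : MvPolynomial (Fin 3) k ≃ₐ[k] PointBlowup.Chart 2 k i,
      θ (X 0) = PointBlowup.exc 2 k i ∧ ∀ j : Fin 3, j ≠ i → θ (X (Equiv.swap 0 i j)) = PointBlowup.frac 2 k i j := by
  obtain ⟨θ₀, h₀i, h₀j⟩ := Cone.exists_algEquiv_pointChart k i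
  refine ⟨(renameEquiv k (Equiv.swap (0 : Fin 3) i)).trans θ₀, ?_, fun j hj => ?_⟩
  · rw [AlgEquiv.trans_apply, renameEquiv_apply, rename_X, Equiv.swap_apply_left, h₀i]
  · rw [AlgEquiv.trans_apply, renameEquiv_apply, rename_X, Equiv.swap_apply_self, h₀j j hj]

include hυ in
/-- ★★ **PACKETS 0, 1, 2 of clause (d)**, uniformly in `i : Fin 3`, in the currency of ✓ p649392: for any twisted chart isomorphism `θ` of `Cᵢ`
(§3 `exists_twisted_algEquiv`): an OPEN IMMERSION `cᵢ' : Spec (k[T]/(f₁)) ⟶ St~` over the polynomial vertex chart `Spec(θ⁻¹) ≫ vertexChart υ i` covering every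
point of `St~` over the range of `vertexChart υ i`, on which `𝓘⟨Z′⟩·𝒪_{St~} = ((T̄₁, T̄₂))~`, with generators whose blow-up algebras are REGULAR RINGS
(✓ `Steiner.isRegularRing_chart₁/₂`) — the per-chart datum `(A, c, g, hJ, hreg)` of ✓ `isRegular_of_isBlowup_of_chartAtlas`. [OURS · L1 W4.5b · (d) packets 0–2] -/
theorem packet_chart (i : Fin 3) (θ : MvPolynomial (Fin 3) k ≃ₐ[k] PointBlowup.Chart 2 k i)
    (hθi : θ (X 0) = PointBlowup.exc 2 k i) (hθj : ∀ j : Fin 3, j ≠ i → θ (X (Equiv.swap 0 i j)) = PointBlowup.frac 2 k i j) :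
    ∃ (c' : Spec (CommRingCat.of (MvPolynomial (Fin 3) k ⧸ Ideal.span {f₁ k})) ⟶
        redSub F₂ (closure (υ ⁻¹' (Set.range (hypersurfaceι (form k)).left \ {vertex 2 k}))) isClosed_closure) (_ : IsOpenImmersion c'),
      c' ≫ redSubι F₂ _ isClosed_closure = Spec.map (CommRingCat.ofHom (Ideal.Quotient.mk (Ideal.span {f₁ k}))) ≫
        (Spec.map (CommRingCat.ofHom (θ.symm.toRingEquiv : PointBlowup.Chart 2 k i →+* MvPolynomial (Fin 3) k)) ≫ vertexChart hυ i) ∧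
      (∀ z, (redSubι F₂ _ isClosed_closure z : F₂) ∈ Set.range (vertexChart hυ i) → z ∈ Set.range c') ∧
      ((vanishingIdeal (⟨⋃ j : Fin 3, vertexLineStrict υ j, isClosed_iUnion_vertexLineStrict υ⟩ : Closeds F₂)).comap
          (redSubι F₂ _ isClosed_closure)).comap c' =
        affineBlowup.idealSheaf (Ideal.span (Set.range fun j : ↥({(0 : Fin 3)}ᶜ : Set (Fin 3)) =>
          Ideal.Quotient.mk (Ideal.span {f₁ k}) (X j.1 : MvPolynomial (Fin 3) k))) ∧
      (∀ j : ↥({(0 : Fin 3)}ᶜ : Set (Fin 3)), IsRegularRing (blowupAlgebra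
        (Ideal.span (Set.range fun j : ↥({(0 : Fin 3)}ᶜ : Set (Fin 3)) => Ideal.Quotient.mk (Ideal.span {f₁ k}) (X j.1 : MvPolynomial (Fin 3) k)))
        (Ideal.Quotient.mk (Ideal.span {f₁ k}) (X j.1 : MvPolynomial (Fin 3) k)))) := by
  haveI : IsReduced (redSub F₂ (closure (υ ⁻¹' (Set.range (hypersurfaceι (form k)).left \ {vertex 2 k}))) isClosed_closure) :=
    ComponentGluing.isReduced_subscheme_vanishingIdeal _
  obtain ⟨hSt, hZ'⟩ := comap_polyChart hυ i θ hθi hθj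
  have hIc : (redSubι F₂ (closure (υ ⁻¹' (Set.range (hypersurfaceι (form k)).left \ {vertex 2 k}))) isClosed_closure).ker.comap
      (Spec.map (CommRingCat.ofHom (θ.symm.toRingEquiv : PointBlowup.Chart 2 k i →+* MvPolynomial (Fin 3) k)) ≫ vertexChart hυ i) =
      affineBlowup.idealSheaf (Ideal.span {f₁ k}) := by
    rw [ker_subschemeι]; exact hSt
  haveI hiso : IsIso (Spec.map (CommRingCat.ofHom (θ.symm.toRingEquiv : PointBlowup.Chart 2 k i →+* MvPolynomial (Fin 3) k))) := by
    change IsIso (Spec.map θ.symm.toRingEquiv.toCommRingCatIso.hom); infer_instance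
  haveI : IsOpenImmersion (Spec.map (CommRingCat.ofHom (θ.symm.toRingEquiv : PointBlowup.Chart 2 k i →+* MvPolynomial (Fin 3) k)) ≫ vertexChart hυ i) :=
    inferInstance
  obtain ⟨c', hc', hcomm, hcov⟩ := exists_openImmersion_specQuotient (redSubι F₂ _ isClosed_closure) _ (Ideal.span {f₁ k}) hIc
  refine ⟨c', hc', hcomm, fun z hz => hcov z ?_, ?_, fun j => ?_⟩
  · obtain ⟨y, hy⟩ := hz
    obtain ⟨y', hy'⟩ := (Scheme.homeoOfIso (asIso (Spec.map (CommRingCat.ofHom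
      (θ.symm.toRingEquiv : PointBlowup.Chart 2 k i →+* MvPolynomial (Fin 3) k))))).surjective y
    refine ⟨y', ?_⟩
    rw [Scheme.Hom.comp_apply]
    have : (Spec.map (CommRingCat.ofHom (θ.symm.toRingEquiv : PointBlowup.Chart 2 k i →+* MvPolynomial (Fin 3) k))) y' = y := hy'
    rw [this, hy]
  · rw [comap_comap_of_chart _ _ _ c' hcomm _ _ hZ', span_range_mk_X_cenVars]
  · obtain ⟨j, hj⟩ := j
    have hj' : j = 1 ∨ j = 2 := by
      have : j ≠ 0 := hj
      fin_cases j <;> simp_all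
    rw [span_range_mk_X_cenVars]
    rcases hj' with rfl | rfl
    · exact isRegularRing_chart₁ k
    · exact isRegularRing_chart₂ k

end Chart

end Steiner

end Summit.ResolutionOfSingularities.ResolutionOfSingularities.Cruxes.EquisingularLiftNat.Sections

end
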